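import Summits.QuantumFields.YangMills.Theorems.UnitScaleTiltProp7Crit93OfEq111T3
import Summits.QuantumFields.YangMills.Theorems.UnitScaleTiltProp7ActionLatticeTransportT3
import HarnessLib

/-!
# Route `UnitScaleTilt`, crux «MinimiserStabilityRegPr» (stmt-QuantumFields-19200, stub EX `stub_existenceMinimalOrbit`, route (α)) — «SECT-C-84 (assembly)»:
# **`hCrit93′` AT THE T³ MEMBER FROM (111) + THE LATTICE (84) ROW** — S9's displayed row `hCrit93′` (the chart ray of `wilsonAction4` is critical along the slice at the
# (111)-solution) as a THEOREM modulo: the class + the slot's Landau guards, the knit's (111), and three displayed inputs with landed suppliers — `hZ` (= lit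
# ✓`B11Eq81ExpansionZpow.hasDerivAt_actionZ_chartRay_real`, ym3-torus-px19 ✓p665027: print's (84) on the lattice, with ITS rows (r74)(r79)(hΔ)(hΔ₁)(hPT)(RC)(hC)),
# `hchart` (= ✓`Prop7SectET3WChartConj.smul_iota_T47_eq_chart`, ym3-torus-px14 ✓p664462, near `t = 0`), `hXR` (= (51) ✓`Prop7FibreELOfCritSplit.isHermitian_trace_zero_chartTwS`)

Cell `ym3-torus` (HUMAN RULING D-0037, YM ladder rung R3 — YM₃ on T³, NOT d = 4, NOT Clay; YM gap NOT proved), width seat `ym3-torus-px21` gen 2 (explicit-unit helper).  THEOREMS ONLY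
(0 `def`, 0 `sorry`); `--supports stmt-QuantumFields-19200 --as helper`, count-neutral; NO claim on crux ∕ stub ∕ registry.  Imports this seat's ✓`Prop7Crit93OfEq111` (the door,
§3 `deriv_eq_zero_of_eq111_of_h84_pair27`) and ✓`Prop7ActionLatticeTransport` ((act) `actionZ_chartCfg_eq_actionRe`).

THE PRINT.  [Balaban1985Variational] (84) p. 290, (93) p. 291 «⟨(δ∕δA′)𝔉(A′), δA′⟩ = 0 for δA′ in (83)», (99)–(111) pp. 293–294, Prop. 5 (112) p. 294; [Balaban1985BackgroundPropagators]
(3.1) p. 390, (3.6)–(3.7) p. 391.  The chain: `wilsonAction4 ∘ emb15 ∘ expHermField ∘ (−I)•χ` = `Re actionRe ∘ chartU ∘ χ` (✓`wilsonAction4_emb15_eq_re`) = `Re (η∕2)·actionZ Tsh η 3 tr (U′U₀)`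
along print's chart ((act) + (G22)) ⟹ derivative `re((η∕2)·(⟨δ′,J⟩ + ⟨δ′,Δ̂ₓA′⟩ + ⟨δ′,W A′⟩))` ((84)) ⟹ `0` on the slice by the door ((99)→(111) backwards).
SLOT REMARK.  Generic `Δx`; the (84) row's `Δ̂ₓ := currentCLM … (Δx U₀)` and lit's displayed (r79) are inhabited at the member by `Δx := DeltaOneJ` (print's `Δ₁`, (79)∕(110)), see
`LOCATE-CRIT93-SLOT-px21g2.md`.
HONEST SCOPE.  Calculus glue over landed letters; every estimate ∕ regime is displayed upstream (px19's rows, (G22)'s windows, (51)); not a proof of any stub; nothing continuum ∕ OS ∕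
mass-gap ∕ Clay.
-/

set_option autoImplicit false

noncomputable section

open scoped InnerProductSpace ComplexConjugate Matrix.Norms.L2Operator BigOperators Topology
open Complex (I)

namespace Summit.QuantumFields.YangMills.Theorems.Prop7Crit93AtMemberOfRow84

open Literature.MathematicalPhysics.QuantumFieldTheory.Balaban1983to89
open Literature.MathematicalPhysics.QuantumFieldTheory.Balaban1983to89.T3ContinuumYM3Torus
open NormedSpace (exp)
open B9SectCLatticeCarrier (Bond)
open B9Eq311L2Pairing (WL2)
open B11Eq115Space (NegSize Space115 JetSup NegSup)
open B11Eq111FrakG (nabla115)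
open B11Eq103H1Complex (SiteL2K BondL2K funEquiv)
open B11Eq98CurrentSlot (Jcur)
open B11Eq90Transpose (pair27)
open B11Eq90V0primeCurrent (Tsh Ucur curL flat115 flat115_apply)
open B9Eq3119DeltaPiCarrier (currentCLM)
open B9Eq39Adjoint (prodCfg)
open B9Eq31ActionZpow (actionZ)
open B11Prop3Model (Dfix)
open T3SectALandauChart (eta emb15 bgUnits)
open Summit.QuantumFields.YangMills.Theorems.Prop7TPrint (expHermField)
open Summit.QuantumFields.YangMills.Theorems.Prop7SectET3Transport (periodsT3 bondEquiv bgOfCfg)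
open Summit.QuantumFields.YangMills.Theorems.Prop7SectET3HilbertLetters (W₂ frobEquiv toL2 DL2 DstarL2)
open Summit.QuantumFields.YangMills.Theorems.Prop7SectET3GaugeProjector (NS RS)
open Summit.QuantumFields.YangMills.Theorems.Prop7SectET3CurvedPropagators
open Summit.QuantumFields.YangMills.Theorems.Prop7SectET3DeltaPi
open Summit.QuantumFields.YangMills.Theorems.Prop7SymAvgTwSym (QTwS CmapTwS)
open Summit.QuantumFields.YangMills.Theorems.Prop7SPrint (IsLandauPrintS)
open Summit.QuantumFields.YangMills.Theorems.Prop7SectET3WilsonHessian (chartU actionRe wilsonAction4_emb15_eq_re)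
open Summit.QuantumFields.YangMills.Theorems.Prop7Crit93OfEq111 (deriv_eq_zero_of_eq111_of_h84_pair27)
open Summit.QuantumFields.YangMills.Theorems.Prop7ActionLatticeTransport (actionZ_chartCfg_eq_actionRe)

variable {F : T3Family} {n K : ℕ} {h : n ≤ K} {c₀ cB a : ℝ} [Fact (0 < c₀)] [Fact (0 < cB)]
  {Δx : GaugeField (F.P K) 0 (Matrix.specialUnitaryGroup (Fin 2) ℂ) → (BondL2K ℂ 3 (periodsT3 F K) c₀ W₂ →ₗ[ℂ] BondL2K ℂ 3 (periodsT3 F K) c₀ W₂)}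
  [Fact (0 < (F.L : ℝ))] [Fact (0 < ((F.L : ℝ)⁻¹) ^ (K - n))]

omit [Fact (0 < (F.L : ℝ))] in
/-- The ray identity: for a Hermitian-traceless exponent `H`, `wilsonAction4 (emb15 U₀ (expHermField H)) = Re actionRe (chartU U₀ (I • H))` (✓`wilsonAction4_emb15_eq_re` at `t = 1`).
[cite: Balaban1987RG1, (0.2) p.252; Balaban1985BackgroundPropagators, (3.6)–(3.7) p.391] -/
theorem wilsonAction4_emb15_expHermField_eq_re (U₀ : GaugeField (F.P K) 0 (Matrix.specialUnitaryGroup (Fin 2) ℂ)) {H : PBond (F.P K) 0 → Matrix (Fin 2) (Fin 2) ℂ}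
    (hH : ∀ b, (H b).IsHermitian ∧ Matrix.trace (H b) = 0) :
    wilsonAction4 (emb15 U₀ (expHermField H)) = (actionRe F K (chartU F K U₀ (Complex.I • H))).re := by
  have h1 := wilsonAction4_emb15_eq_re (F := F) (K := K) U₀ hH 1
  have hfun : (fun b => ((1 : ℝ) : ℂ) • H b) = H := funext fun b => by rw [Complex.ofReal_one, one_smul]
  rw [hfun, Complex.ofReal_one, one_smul] at h1
  exact h1

/-- ★★★ **`hCrit93′` AT THE T³ MEMBER FROM (111) + THE LATTICE (84) ROW** («SECT-C-84», assembly; generic slot `Δx`, generic letters `W` (print's `(δ∕δA′)V`) and `Tc` (print's chart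
`A′ ↦ A′ − HD(A′)`, (47))).  From: the class + the slot's two Landau guards; the knit's (111) at `J := Jcur (bgOfCfg U₀)`, `W (A₁ + H₁f B̃)`; a slice direction `δ′` read as `δ` in the ray (`ιδ′` Hermitian; the link `δ = κ_f • ιδ′` lives in `hchart`,
`QTwS U₀ ιδ′ = 0`, Landau); **`hZ`** = the conclusion of lit ✓`B11Eq81ExpansionZpow.hasDerivAt_actionZ_chartRay_real` at `Δ₁ := currentCLM … (Δx U₀)`, `A′ := A₁ + H₁f B̃` (print's (84) on
the lattice, its rows (r74)(r79)(hΔ)(hΔ₁)(hPT)(RC)(hC) displayed THERE); **`hchart`** = the chart conjugacy near `t = 0` (✓`Prop7SectET3WChartConj.smul_iota_T47_eq_chart`, (G22), + continuity);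
**`hXR`** = reality of the chart value ((51), ✓`Prop7FibreELOfCritSplit.isHermitian_trace_zero_chartTwS`) — conclude S9's `hCrit93′` text at the member: the chart ray of `wilsonAction4` has
zero derivative at `0`.  Proof = `hZ` ∘ (act) ✓`actionZ_chartCfg_eq_actionRe` ∘ `hchart` ∘ the ray identity ∘ `re` ∘ the door ✓`deriv_eq_zero_of_eq111_of_h84_pair27` with `κ := η∕2`.
[cite: Balaban1985Variational, (84) p.290, (93) p.291, (99) p.293, (111)–(112) p.294; Balaban1985BackgroundPropagators, (3.1) p.390, (3.6)–(3.7) p.391] -/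
theorem deriv_chartRay_eq_zero_of_eq111_of_hasDerivAt_actionZ
    {U₀ : GaugeField (F.P K) 0 (Matrix.specialUnitaryGroup (Fin 2) ℂ)} (hp : PosOnto F n K h c₀ cB a Δx U₀)
    (hΔ : ∀ l ∈ NS F n K h c₀ cB U₀, Δx U₀ (DL2 F n K c₀ U₀ l) = 0) (hΔ' : ∀ l ∈ NS F n K h c₀ cB U₀, ∀ w, ⟪DL2 F n K c₀ U₀ l, Δx U₀ w⟫_ℂ = 0)
    (A₁ : Space115 (F.L : ℝ) (((F.L : ℝ)⁻¹) ^ (K - n)) (fun _ : Bond 3 (periodsT3 F K) => K - n) (fun _ : Bond 3 (periodsT3 F K) × Fin 3 => K - n)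
      (nabla115 (((F.L : ℝ)⁻¹) ^ (K - n)) (bgOfCfg F K U₀)))
    (W : Space115 (F.L : ℝ) (((F.L : ℝ)⁻¹) ^ (K - n)) (fun _ : Bond 3 (periodsT3 F K) => K - n) (fun _ : Bond 3 (periodsT3 F K) × Fin 3 => K - n)
        (nabla115 (((F.L : ℝ)⁻¹) ^ (K - n)) (bgOfCfg F K U₀)) →
      NegSize (F.L : ℝ) (((F.L : ℝ)⁻¹) ^ (K - n)) (fun _ : Bond 3 (periodsT3 F K) => K - n) 3 (Matrix (Fin 2) (Fin 2) ℂ))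
    (Tc : Space115 (F.L : ℝ) (((F.L : ℝ)⁻¹) ^ (K - n)) (fun _ : Bond 3 (periodsT3 F K) => K - n) (fun _ : Bond 3 (periodsT3 F K) × Fin 3 => K - n)
        (nabla115 (((F.L : ℝ)⁻¹) ^ (K - n)) (bgOfCfg F K U₀)) →
      Space115 (F.L : ℝ) (((F.L : ℝ)⁻¹) ^ (K - n)) (fun _ : Bond 3 (periodsT3 F K) => K - n) (fun _ : Bond 3 (periodsT3 F K) × Fin 3 => K - n)
        (nabla115 (((F.L : ℝ)⁻¹) ^ (K - n)) (bgOfCfg F K U₀)))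
    (B : PBond (F.P n) 0 → Matrix (Fin 2) (Fin 2) ℂ)
    (heq : A₁ + frakGfR F n K h c₀ cB a Δx U₀ (Jcur (bgOfCfg F K U₀)) + frakGfR F n K h c₀ cB a Δx U₀ (W (A₁ + H1f F n K h c₀ cB a Δx U₀ B)) = 0)
    (C₂ : ℝ) (δ : PBond (F.P K) 0 → Matrix (Fin 2) (Fin 2) ℂ)
    {δ' : Space115 (F.L : ℝ) (((F.L : ℝ)⁻¹) ^ (K - n)) (fun _ : Bond 3 (periodsT3 F K) => K - n) (fun _ : Bond 3 (periodsT3 F K) × Fin 3 => K - n)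
      (nabla115 (((F.L : ℝ)⁻¹) ^ (K - n)) (bgOfCfg F K U₀))}
    (hδR : ∀ b : PBond (F.P K) 0, star (JetSup.equiv _ _ _ δ' (bondEquiv F K b)) = JetSup.equiv _ _ _ δ' (bondEquiv F K b))
    (hδQ : QTwS F n K h U₀ (fun b : PBond (F.P K) 0 => JetSup.equiv _ _ _ δ' (bondEquiv F K b)) = 0)
    (hδL : IsLandauPrintS F n K h c₀ cB U₀ (fun b : PBond (F.P K) 0 => JetSup.equiv _ _ _ δ' (bondEquiv F K b)))
    (hZ : HasDerivAt (fun t : ℝ => actionZ Tsh (((F.L : ℝ)⁻¹) ^ (K - n)) 3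
        ((LinearMap.toContinuousLinearMap (Matrix.traceLinearMap (Fin 2) ℂ ℂ) : Matrix (Fin 2) (Fin 2) ℂ →L[ℂ] ℂ) : Matrix (Fin 2) (Fin 2) ℂ →ₗ[ℂ] ℂ)
        (prodCfg (Ucur (bgOfCfg F K U₀)) (((F.L : ℝ)⁻¹) ^ (K - n)) (curL (flat115 (Tc (A₁ + H1f F n K h c₀ cB a Δx U₀ B + (t : ℂ) • δ'))))))
      (pair27 (LinearMap.toContinuousLinearMap (Matrix.traceLinearMap (Fin 2) ℂ ℂ)) (Jcur (bgOfCfg F K U₀) : NegSize (F.L : ℝ) (((F.L : ℝ)⁻¹) ^ (K - n)) (fun _ : Bond 3 (periodsT3 F K) => K - n) 3 (Matrix (Fin 2) (Fin 2) ℂ)) (flat115 δ')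
        + pair27 (LinearMap.toContinuousLinearMap (Matrix.traceLinearMap (Fin 2) ℂ ℂ))
            (currentCLM frobEquiv (fun _ : Bond 3 (periodsT3 F K) × Fin 3 => K - n) (nabla115 (((F.L : ℝ)⁻¹) ^ (K - n)) (bgOfCfg F K U₀)) (Δx U₀) (A₁ + H1f F n K h c₀ cB a Δx U₀ B))
            (flat115 δ')
        + pair27 (LinearMap.toContinuousLinearMap (Matrix.traceLinearMap (Fin 2) ℂ ℂ)) (W (A₁ + H1f F n K h c₀ cB a Δx U₀ B)) (flat115 δ')) 0)
    (hchart : ∀ᶠ t : ℝ in nhds 0,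
      ((((eta F n K : ℝ) : ℂ)) * Complex.I) • (fun b : PBond (F.P K) 0 => JetSup.equiv _ _ _ (Tc (A₁ + H1f F n K h c₀ cB a Δx U₀ B + (t : ℂ) • δ')) (bondEquiv F K b))
        = ((((eta F n K : ℝ) : ℂ)) * Complex.I) • ((fun b : PBond (F.P K) 0 => JetSup.equiv _ _ _ A₁ (bondEquiv F K b))
              + (fun b : PBond (F.P K) 0 => JetSup.equiv _ _ _ (H1f F n K h c₀ cB a Δx U₀ B) (bondEquiv F K b))) + (t : ℂ) • δ
          - H46 F n K h c₀ cB a U₀ (Dfix (CmapTwS F n K h U₀) (H46 F n K h c₀ cB a U₀) C₂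
              (((((eta F n K : ℝ) : ℂ)) * Complex.I) • ((fun b : PBond (F.P K) 0 => JetSup.equiv _ _ _ A₁ (bondEquiv F K b))
              + (fun b : PBond (F.P K) 0 => JetSup.equiv _ _ _ (H1f F n K h c₀ cB a Δx U₀ B) (bondEquiv F K b))) + (t : ℂ) • δ)))
    (hXR : ∀ (t : ℝ) (b' : PBond (F.P K) 0),
      (((-Complex.I) • (((((eta F n K : ℝ) : ℂ)) * Complex.I) • ((fun b : PBond (F.P K) 0 => JetSup.equiv _ _ _ A₁ (bondEquiv F K b))
              + (fun b : PBond (F.P K) 0 => JetSup.equiv _ _ _ (H1f F n K h c₀ cB a Δx U₀ B) (bondEquiv F K b))) + (t : ℂ) • δ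
          - H46 F n K h c₀ cB a U₀ (Dfix (CmapTwS F n K h U₀) (H46 F n K h c₀ cB a U₀) C₂
              (((((eta F n K : ℝ) : ℂ)) * Complex.I) • ((fun b : PBond (F.P K) 0 => JetSup.equiv _ _ _ A₁ (bondEquiv F K b))
              + (fun b : PBond (F.P K) 0 => JetSup.equiv _ _ _ (H1f F n K h c₀ cB a Δx U₀ B) (bondEquiv F K b))) + (t : ℂ) • δ)))) b').IsHermitian ∧
      Matrix.trace (((-Complex.I) • (((((eta F n K : ℝ) : ℂ)) * Complex.I) • ((fun b : PBond (F.P K) 0 => JetSup.equiv _ _ _ A₁ (bondEquiv F K b))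
              + (fun b : PBond (F.P K) 0 => JetSup.equiv _ _ _ (H1f F n K h c₀ cB a Δx U₀ B) (bondEquiv F K b))) + (t : ℂ) • δ
          - H46 F n K h c₀ cB a U₀ (Dfix (CmapTwS F n K h U₀) (H46 F n K h c₀ cB a U₀) C₂
              (((((eta F n K : ℝ) : ℂ)) * Complex.I) • ((fun b : PBond (F.P K) 0 => JetSup.equiv _ _ _ A₁ (bondEquiv F K b))
              + (fun b : PBond (F.P K) 0 => JetSup.equiv _ _ _ (H1f F n K h c₀ cB a Δx U₀ B) (bondEquiv F K b))) + (t : ℂ) • δ)))) b') = 0) :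
    deriv (fun t : ℝ => wilsonAction4 (emb15 U₀ (expHermField (fun b' : PBond (F.P K) 0 => (-Complex.I) •
      (((((eta F n K : ℝ) : ℂ)) * Complex.I) • ((fun b : PBond (F.P K) 0 => JetSup.equiv _ _ _ A₁ (bondEquiv F K b))
          + (fun b : PBond (F.P K) 0 => JetSup.equiv _ _ _ (H1f F n K h c₀ cB a Δx U₀ B) (bondEquiv F K b))) + (t : ℂ) • δ
        - H46 F n K h c₀ cB a U₀ (Dfix (CmapTwS F n K h U₀) (H46 F n K h c₀ cB a U₀) C₂
            (((((eta F n K : ℝ) : ℂ)) * Complex.I) • ((fun b : PBond (F.P K) 0 => JetSup.equiv _ _ _ A₁ (bondEquiv F K b))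
            + (fun b : PBond (F.P K) 0 => JetSup.equiv _ _ _ (H1f F n K h c₀ cB a Δx U₀ B) (bondEquiv F K b))) + (t : ℂ) • δ))) b')))) 0 = 0 := by
  -- abbreviations
  set X : PBond (F.P K) 0 → Matrix (Fin 2) (Fin 2) ℂ := ((((eta F n K : ℝ) : ℂ)) * Complex.I) •
    ((fun b : PBond (F.P K) 0 => JetSup.equiv _ _ _ A₁ (bondEquiv F K b)) + (fun b : PBond (F.P K) 0 => JetSup.equiv _ _ _ (H1f F n K h c₀ cB a Δx U₀ B) (bondEquiv F K b)))
    with hX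
  set χ : (PBond (F.P K) 0 → Matrix (Fin 2) (Fin 2) ℂ) → (PBond (F.P K) 0 → Matrix (Fin 2) (Fin 2) ℂ) := fun Y =>
    Y - H46 F n K h c₀ cB a U₀ (Dfix (CmapTwS F n K h U₀) (H46 F n K h c₀ cB a U₀) C₂ Y) with hχ
  set g : ℝ → ℂ := fun t => actionRe F K (chartU F K U₀ (χ (X + (t : ℂ) • δ))) with hg
  have hη : eta F n K = ((F.L : ℝ)⁻¹) ^ (K - n) := rfl
  have hηpos : (0 : ℝ) < eta F n K := T3SectALandauChart.eta_pos F n K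
  have hηne : (((eta F n K : ℝ) : ℂ)) ≠ 0 := Complex.ofReal_ne_zero.2 hηpos.ne'
  -- (act) + hchart: near `t = 0`, lit's `actionZ` along px19's ray is `η⁻¹·2·g t`
  have hZ' : HasDerivAt (fun t : ℝ => (((eta F n K : ℝ) : ℂ))⁻¹ * (2 * g t))
      (pair27 (LinearMap.toContinuousLinearMap (Matrix.traceLinearMap (Fin 2) ℂ ℂ)) (Jcur (bgOfCfg F K U₀) : NegSize (F.L : ℝ) (((F.L : ℝ)⁻¹) ^ (K - n)) (fun _ : Bond 3 (periodsT3 F K) => K - n) 3 (Matrix (Fin 2) (Fin 2) ℂ)) (flat115 δ')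
        + pair27 (LinearMap.toContinuousLinearMap (Matrix.traceLinearMap (Fin 2) ℂ ℂ))
            (currentCLM frobEquiv (fun _ : Bond 3 (periodsT3 F K) × Fin 3 => K - n) (nabla115 (((F.L : ℝ)⁻¹) ^ (K - n)) (bgOfCfg F K U₀)) (Δx U₀) (A₁ + H1f F n K h c₀ cB a Δx U₀ B))
            (flat115 δ')
        + pair27 (LinearMap.toContinuousLinearMap (Matrix.traceLinearMap (Fin 2) ℂ ℂ)) (W (A₁ + H1f F n K h c₀ cB a Δx U₀ B)) (flat115 δ')) 0 := by
    refine hZ.congr_of_eventuallyEq ?_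
    filter_upwards [hchart] with t ht
    have hact := actionZ_chartCfg_eq_actionRe (F := F) (K := K) U₀ (eta F n K) (Tc (A₁ + H1f F n K h c₀ cB a Δx U₀ B + (t : ℂ) • δ'))
    rw [ht] at hact
    exact hact.symm
  -- undo the constant `2η⁻¹`
  have hg' := hZ'.const_mul ((((eta F n K : ℝ) : ℂ)) / 2)
  have hgfun : (fun t : ℝ => (((eta F n K : ℝ) : ℂ)) / 2 * ((((eta F n K : ℝ) : ℂ))⁻¹ * (2 * g t))) = g := by
    funext t
    field_simp
  rw [hgfun] at hg'
  -- the ray: `f t = (g t).re`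
  have hf : (fun t : ℝ => wilsonAction4 (emb15 U₀ (expHermField (fun b' : PBond (F.P K) 0 => (-Complex.I) • (χ (X + (t : ℂ) • δ)) b'))))
      = fun t : ℝ => (g t).re := by
    funext t
    refine (wilsonAction4_emb15_expHermField_eq_re U₀ (hXR t)).trans ?_
    congr 3
    funext b
    simp only [Pi.smul_apply, smul_smul, mul_neg, Complex.I_mul_I, neg_neg, one_smul]
    rfl
  have h84 : HasDerivAt (fun t : ℝ => wilsonAction4 (emb15 U₀ (expHermField (fun b' : PBond (F.P K) 0 => (-Complex.I) • (χ (X + (t : ℂ) • δ)) b'))))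
      (RCLike.re (((((eta F n K : ℝ) : ℂ)) / 2) *
        (pair27 (LinearMap.toContinuousLinearMap (Matrix.traceLinearMap (Fin 2) ℂ ℂ)) (Jcur (bgOfCfg F K U₀) : NegSize (F.L : ℝ) (((F.L : ℝ)⁻¹) ^ (K - n)) (fun _ : Bond 3 (periodsT3 F K) => K - n) 3 (Matrix (Fin 2) (Fin 2) ℂ)) (flat115 δ')
        + pair27 (LinearMap.toContinuousLinearMap (Matrix.traceLinearMap (Fin 2) ℂ ℂ))
            (currentCLM frobEquiv (fun _ : Bond 3 (periodsT3 F K) × Fin 3 => K - n) (nabla115 (((F.L : ℝ)⁻¹) ^ (K - n)) (bgOfCfg F K U₀)) (Δx U₀) (A₁ + H1f F n K h c₀ cB a Δx U₀ B))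
            (flat115 δ')
        + pair27 (LinearMap.toContinuousLinearMap (Matrix.traceLinearMap (Fin 2) ℂ ℂ)) (W (A₁ + H1f F n K h c₀ cB a Δx U₀ B)) (flat115 δ')))) 0 := by
    rw [hf]
    have hre := (Complex.reCLM.hasFDerivAt.comp_hasDerivAt (0 : ℝ) hg')
    simpa only [Function.comp_def, Complex.reCLM_apply, RCLike.re_to_complex] using hre
  exact deriv_eq_zero_of_eq111_of_h84_pair27 hp hΔ hΔ' A₁ (Jcur (bgOfCfg F K U₀)) (W (A₁ + H1f F n K h c₀ cB a Δx U₀ B)) B heq hδR hδQ hδL h84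

/-! ## §2 (v1.1) The same assembly with the EXPONENT-UNITS CHART `χ` GENERIC (survives `H46 ↦ H46ᴾ`, ★★OWNER RULING g28-№4 (C2′), and any re-lettering of the EX display's chart) -/

/-- ★★★ **S9's `hCrit93′` MEMBER TEXT FROM (111) + THE LATTICE (84), CHART-GENERIC**: as `deriv_chartRay_eq_zero_of_eq111_of_hasDerivAt_actionZ`, with the EX display's exponent-units chart an
ARBITRARY map `χ` (today `χ X = X − H46 U₀ (Dfix (CmapTwS U₀) (H46 U₀) C₂ X)`; after the PINV cascade the same with `H46ᴾ`): the rows `hchart` (eventual conjugacy `κ_f • ι(Tc (A′ + tδ′)) = χ(κ_f • ιA′ + tδ)`,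
✓`Prop7ChartRayContinuity.eventually_chart_eq_of_pointwise`) and `hXR` (reality of `(−I)•χ(…)`) are stated through `χ`, and so is the conclusion `deriv (t ↦ wilsonAction4 (e^{(−I)•χ(X + tδ)}·U₀)) 0 = 0`.
[cite: Balaban1985Variational, (84) p.290, (93) p.291, (111)–(112) p.294; Balaban1985BackgroundPropagators, (3.1) p.390, (3.11) p.392] -/
theorem deriv_chartRay_eq_zero_of_eq111_of_hasDerivAt_actionZ_chart
    {U₀ : GaugeField (F.P K) 0 (Matrix.specialUnitaryGroup (Fin 2) ℂ)} (hp : PosOnto F n K h c₀ cB a Δx U₀)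
    (hΔ : ∀ l ∈ NS F n K h c₀ cB U₀, Δx U₀ (DL2 F n K c₀ U₀ l) = 0) (hΔ' : ∀ l ∈ NS F n K h c₀ cB U₀, ∀ w, ⟪DL2 F n K c₀ U₀ l, Δx U₀ w⟫_ℂ = 0)
    (A₁ : Space115 (F.L : ℝ) (((F.L : ℝ)⁻¹) ^ (K - n)) (fun _ : Bond 3 (periodsT3 F K) => K - n) (fun _ : Bond 3 (periodsT3 F K) × Fin 3 => K - n)
      (nabla115 (((F.L : ℝ)⁻¹) ^ (K - n)) (bgOfCfg F K U₀)))
    (W : Space115 (F.L : ℝ) (((F.L : ℝ)⁻¹) ^ (K - n)) (fun _ : Bond 3 (periodsT3 F K) => K - n) (fun _ : Bond 3 (periodsT3 F K) × Fin 3 => K - n)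
        (nabla115 (((F.L : ℝ)⁻¹) ^ (K - n)) (bgOfCfg F K U₀)) →
      NegSize (F.L : ℝ) (((F.L : ℝ)⁻¹) ^ (K - n)) (fun _ : Bond 3 (periodsT3 F K) => K - n) 3 (Matrix (Fin 2) (Fin 2) ℂ))
    (Tc : Space115 (F.L : ℝ) (((F.L : ℝ)⁻¹) ^ (K - n)) (fun _ : Bond 3 (periodsT3 F K) => K - n) (fun _ : Bond 3 (periodsT3 F K) × Fin 3 => K - n)
        (nabla115 (((F.L : ℝ)⁻¹) ^ (K - n)) (bgOfCfg F K U₀)) →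
      Space115 (F.L : ℝ) (((F.L : ℝ)⁻¹) ^ (K - n)) (fun _ : Bond 3 (periodsT3 F K) => K - n) (fun _ : Bond 3 (periodsT3 F K) × Fin 3 => K - n)
        (nabla115 (((F.L : ℝ)⁻¹) ^ (K - n)) (bgOfCfg F K U₀)))
    (B : PBond (F.P n) 0 → Matrix (Fin 2) (Fin 2) ℂ)
    (heq : A₁ + frakGfR F n K h c₀ cB a Δx U₀ (Jcur (bgOfCfg F K U₀)) + frakGfR F n K h c₀ cB a Δx U₀ (W (A₁ + H1f F n K h c₀ cB a Δx U₀ B)) = 0)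
    (χ : (PBond (F.P K) 0 → Matrix (Fin 2) (Fin 2) ℂ) → (PBond (F.P K) 0 → Matrix (Fin 2) (Fin 2) ℂ)) (δ : PBond (F.P K) 0 → Matrix (Fin 2) (Fin 2) ℂ)
    {δ' : Space115 (F.L : ℝ) (((F.L : ℝ)⁻¹) ^ (K - n)) (fun _ : Bond 3 (periodsT3 F K) => K - n) (fun _ : Bond 3 (periodsT3 F K) × Fin 3 => K - n)
      (nabla115 (((F.L : ℝ)⁻¹) ^ (K - n)) (bgOfCfg F K U₀))}
    (hδR : ∀ b : PBond (F.P K) 0, star (JetSup.equiv _ _ _ δ' (bondEquiv F K b)) = JetSup.equiv _ _ _ δ' (bondEquiv F K b))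
    (hδQ : QTwS F n K h U₀ (fun b : PBond (F.P K) 0 => JetSup.equiv _ _ _ δ' (bondEquiv F K b)) = 0)
    (hδL : IsLandauPrintS F n K h c₀ cB U₀ (fun b : PBond (F.P K) 0 => JetSup.equiv _ _ _ δ' (bondEquiv F K b)))
    (hZ : HasDerivAt (fun t : ℝ => actionZ Tsh (((F.L : ℝ)⁻¹) ^ (K - n)) 3
        ((LinearMap.toContinuousLinearMap (Matrix.traceLinearMap (Fin 2) ℂ ℂ) : Matrix (Fin 2) (Fin 2) ℂ →L[ℂ] ℂ) : Matrix (Fin 2) (Fin 2) ℂ →ₗ[ℂ] ℂ)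
        (prodCfg (Ucur (bgOfCfg F K U₀)) (((F.L : ℝ)⁻¹) ^ (K - n)) (curL (flat115 (Tc (A₁ + H1f F n K h c₀ cB a Δx U₀ B + (t : ℂ) • δ'))))))
      (pair27 (LinearMap.toContinuousLinearMap (Matrix.traceLinearMap (Fin 2) ℂ ℂ)) (Jcur (bgOfCfg F K U₀) : NegSize (F.L : ℝ) (((F.L : ℝ)⁻¹) ^ (K - n)) (fun _ : Bond 3 (periodsT3 F K) => K - n) 3 (Matrix (Fin 2) (Fin 2) ℂ)) (flat115 δ')
        + pair27 (LinearMap.toContinuousLinearMap (Matrix.traceLinearMap (Fin 2) ℂ ℂ))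
            (currentCLM frobEquiv (fun _ : Bond 3 (periodsT3 F K) × Fin 3 => K - n) (nabla115 (((F.L : ℝ)⁻¹) ^ (K - n)) (bgOfCfg F K U₀)) (Δx U₀) (A₁ + H1f F n K h c₀ cB a Δx U₀ B))
            (flat115 δ')
        + pair27 (LinearMap.toContinuousLinearMap (Matrix.traceLinearMap (Fin 2) ℂ ℂ)) (W (A₁ + H1f F n K h c₀ cB a Δx U₀ B)) (flat115 δ')) 0)
    (hchart : ∀ᶠ t : ℝ in nhds 0,
      ((((eta F n K : ℝ) : ℂ)) * Complex.I) • (fun b : PBond (F.P K) 0 => JetSup.equiv _ _ _ (Tc (A₁ + H1f F n K h c₀ cB a Δx U₀ B + (t : ℂ) • δ')) (bondEquiv F K b))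
        = χ (((((eta F n K : ℝ) : ℂ)) * Complex.I) • ((fun b : PBond (F.P K) 0 => JetSup.equiv _ _ _ A₁ (bondEquiv F K b))
              + (fun b : PBond (F.P K) 0 => JetSup.equiv _ _ _ (H1f F n K h c₀ cB a Δx U₀ B) (bondEquiv F K b))) + (t : ℂ) • δ))
    (hXR : ∀ (t : ℝ) (b' : PBond (F.P K) 0),
      (((-Complex.I) • χ (((((eta F n K : ℝ) : ℂ)) * Complex.I) • ((fun b : PBond (F.P K) 0 => JetSup.equiv _ _ _ A₁ (bondEquiv F K b))
              + (fun b : PBond (F.P K) 0 => JetSup.equiv _ _ _ (H1f F n K h c₀ cB a Δx U₀ B) (bondEquiv F K b))) + (t : ℂ) • δ)) b').IsHermitian ∧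
      Matrix.trace (((-Complex.I) • χ (((((eta F n K : ℝ) : ℂ)) * Complex.I) • ((fun b : PBond (F.P K) 0 => JetSup.equiv _ _ _ A₁ (bondEquiv F K b))
              + (fun b : PBond (F.P K) 0 => JetSup.equiv _ _ _ (H1f F n K h c₀ cB a Δx U₀ B) (bondEquiv F K b))) + (t : ℂ) • δ)) b') = 0) :
    deriv (fun t : ℝ => wilsonAction4 (emb15 U₀ (expHermField (fun b' : PBond (F.P K) 0 => (-Complex.I) •
      (χ (((((eta F n K : ℝ) : ℂ)) * Complex.I) • ((fun b : PBond (F.P K) 0 => JetSup.equiv _ _ _ A₁ (bondEquiv F K b))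
          + (fun b : PBond (F.P K) 0 => JetSup.equiv _ _ _ (H1f F n K h c₀ cB a Δx U₀ B) (bondEquiv F K b))) + (t : ℂ) • δ)) b')))) 0 = 0 := by
  -- abbreviations
  set X : PBond (F.P K) 0 → Matrix (Fin 2) (Fin 2) ℂ := ((((eta F n K : ℝ) : ℂ)) * Complex.I) •
    ((fun b : PBond (F.P K) 0 => JetSup.equiv _ _ _ A₁ (bondEquiv F K b)) + (fun b : PBond (F.P K) 0 => JetSup.equiv _ _ _ (H1f F n K h c₀ cB a Δx U₀ B) (bondEquiv F K b)))
    with hX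
  set g : ℝ → ℂ := fun t => actionRe F K (chartU F K U₀ (χ (X + (t : ℂ) • δ))) with hg
  have hη : eta F n K = ((F.L : ℝ)⁻¹) ^ (K - n) := rfl
  have hηpos : (0 : ℝ) < eta F n K := T3SectALandauChart.eta_pos F n K
  have hηne : (((eta F n K : ℝ) : ℂ)) ≠ 0 := Complex.ofReal_ne_zero.2 hηpos.ne'
  -- (act) + hchart: near `t = 0`, lit's `actionZ` along the lattice ray is `η⁻¹·2·g t`
  have hZ' : HasDerivAt (fun t : ℝ => (((eta F n K : ℝ) : ℂ))⁻¹ * (2 * g t))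
      (pair27 (LinearMap.toContinuousLinearMap (Matrix.traceLinearMap (Fin 2) ℂ ℂ)) (Jcur (bgOfCfg F K U₀) : NegSize (F.L : ℝ) (((F.L : ℝ)⁻¹) ^ (K - n)) (fun _ : Bond 3 (periodsT3 F K) => K - n) 3 (Matrix (Fin 2) (Fin 2) ℂ)) (flat115 δ')
        + pair27 (LinearMap.toContinuousLinearMap (Matrix.traceLinearMap (Fin 2) ℂ ℂ))
            (currentCLM frobEquiv (fun _ : Bond 3 (periodsT3 F K) × Fin 3 => K - n) (nabla115 (((F.L : ℝ)⁻¹) ^ (K - n)) (bgOfCfg F K U₀)) (Δx U₀) (A₁ + H1f F n K h c₀ cB a Δx U₀ B))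
            (flat115 δ')
        + pair27 (LinearMap.toContinuousLinearMap (Matrix.traceLinearMap (Fin 2) ℂ ℂ)) (W (A₁ + H1f F n K h c₀ cB a Δx U₀ B)) (flat115 δ')) 0 := by
    refine hZ.congr_of_eventuallyEq ?_
    filter_upwards [hchart] with t ht
    have hact := actionZ_chartCfg_eq_actionRe (F := F) (K := K) U₀ (eta F n K) (Tc (A₁ + H1f F n K h c₀ cB a Δx U₀ B + (t : ℂ) • δ'))
    rw [ht] at hact
    exact hact.symm
  -- undo the constant `2η⁻¹`
  have hg' := hZ'.const_mul ((((eta F n K : ℝ) : ℂ)) / 2)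
  have hgfun : (fun t : ℝ => (((eta F n K : ℝ) : ℂ)) / 2 * ((((eta F n K : ℝ) : ℂ))⁻¹ * (2 * g t))) = g := by
    funext t
    field_simp
  rw [hgfun] at hg'
  -- the ray: `f t = (g t).re`
  have hf : (fun t : ℝ => wilsonAction4 (emb15 U₀ (expHermField (fun b' : PBond (F.P K) 0 => (-Complex.I) • (χ (X + (t : ℂ) • δ)) b'))))
      = fun t : ℝ => (g t).re := by
    funext t
    refine (wilsonAction4_emb15_expHermField_eq_re U₀ (hXR t)).trans ?_
    congr 3
    funext b
    simp only [Pi.smul_apply, smul_smul, mul_neg, Complex.I_mul_I, neg_neg, one_smul]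
  have h84 : HasDerivAt (fun t : ℝ => wilsonAction4 (emb15 U₀ (expHermField (fun b' : PBond (F.P K) 0 => (-Complex.I) • (χ (X + (t : ℂ) • δ)) b'))))
      (RCLike.re (((((eta F n K : ℝ) : ℂ)) / 2) *
        (pair27 (LinearMap.toContinuousLinearMap (Matrix.traceLinearMap (Fin 2) ℂ ℂ)) (Jcur (bgOfCfg F K U₀) : NegSize (F.L : ℝ) (((F.L : ℝ)⁻¹) ^ (K - n)) (fun _ : Bond 3 (periodsT3 F K) => K - n) 3 (Matrix (Fin 2) (Fin 2) ℂ)) (flat115 δ')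
        + pair27 (LinearMap.toContinuousLinearMap (Matrix.traceLinearMap (Fin 2) ℂ ℂ))
            (currentCLM frobEquiv (fun _ : Bond 3 (periodsT3 F K) × Fin 3 => K - n) (nabla115 (((F.L : ℝ)⁻¹) ^ (K - n)) (bgOfCfg F K U₀)) (Δx U₀) (A₁ + H1f F n K h c₀ cB a Δx U₀ B))
            (flat115 δ')
        + pair27 (LinearMap.toContinuousLinearMap (Matrix.traceLinearMap (Fin 2) ℂ ℂ)) (W (A₁ + H1f F n K h c₀ cB a Δx U₀ B)) (flat115 δ')))) 0 := by
    rw [hf]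
    have hre := (Complex.reCLM.hasFDerivAt.comp_hasDerivAt (0 : ℝ) hg')
    simpa only [Function.comp_def, Complex.reCLM_apply, RCLike.re_to_complex] using hre
  exact deriv_eq_zero_of_eq111_of_h84_pair27 hp hΔ hΔ' A₁ (Jcur (bgOfCfg F K U₀)) (W (A₁ + H1f F n K h c₀ cB a Δx U₀ B)) B heq hδR hδQ hδL h84

end Summit.QuantumFields.YangMills.Theorems.Prop7Crit93AtMemberOfRow84

end
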